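import Summits.FinalStateConjecture.FinalStateConjecture.Theses.BartnikGapSettling
import Literature.Geometry.Lorentzian.TameGenericityDiagonal
import Summits.FinalStateConjecture.FinalStateConjecture.Theorems.GenericCensorshipCollarMargin.Negative.GenericCensorshipCollarMarginFalseOfExtremalJunkCollars

/-!
# Birth skeleton (BC3) for crux `TameCensorshipCollarMargin` (stmt-FinalStateConjecture-17329),
# route `BartnikGapSettling` — "censorship curves, then the collar third law along them"

planner-skel-stmt-FinalStateConjecture-17329-0 (skeleton registrar, route re-audit bin HONEST-BET),
2026-08-17. Target: the route decl
`Summit.FinalStateConjecture.FinalStateConjecture.Theses.BartnikGapSettling.TameCensorshipCollarMargin`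
BY NAME (rev 6 of the route file), concluded by `TameCensorshipCollarMargin_of` from three named stubs.

## The line (the route's own two-layer plan "CensorshipCurves → ThirdLawCollarCurves → joint
## transversality, with TAME curves on the fixed end", typed over the landed tame kernel)

Tame Christodoulou genericity is not closed under `∧`, so the crux — ONE tame-generic statement
"every MGHD has complete `𝓘⁺` AND the collar margin" — cannot be split as a conjunction. The
landed kernel `InitialDataSet.isTameChristodoulouGeneric_of_relative` (`TameGenericityDiagonal.lean`,
sorry-free) is the door: a generic HYPOTHESIS `Q` (weak cosmic censorship) enters the proof of a
generic CONCLUSION `P` by producing `P` along tame `Q`-curves. Hence: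

* `stub_tameCensorship` — TAME WEAK COSMIC CENSORSHIP: tame-generically in the admissible class,
  every MGHD has complete future null infinity (sojourn form). (Implied, by
  `IsTameChristodoulouGeneric.mono`, by the sibling item `PhaseMixingCapture.WeakCosmicCensorshipTame`,
  which carries the extra anti-vacuity conjunct `∃ 𝒟, 𝒟.IsMaximal`.) Open problem.
* `stub_windowedThirdLawAlongCensoredCurves` — THE COLLAR THIRD LAW ALONG CENSORED TAME CURVES
  (the load-bearing stub): for every end `e` and every tame curve `F` of admissible data on `e`
  whose members off `0` are censored (`F` immersed at `0` and injective, or constant), there is a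
  tame, injective, immersed curve `F'` of admissible data on the SAME end through the same base
  datum whose members off `0` are censored AND satisfy the WINDOWED collar margin C‴₂ — for every
  label window `[m₀, m₀⁻¹]` and boost bound `ρ₀` some `χ₁ < 1`, `δ₁ > 0`, compact `K₁` such that
  every thick collar chart of windowed label and bounded boost, `δ₁`-quiet in `C²` on its slab and
  beyond `J⁻(K₁)`, has `|a₁| ≤ χ₁ M₁` (the generic third law of black-hole mechanics in collar
  form: Kehle–Unger's extremal threshold is a hypersurface one can leave along a tame curve while
  staying censored). The clause is the 10809 leads' converged restatement C‴ (label AND boost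
  windowed before the tolerance, `Cruxes/GenericCensorshipCollarMargin/RestatementProbeC3.lean`,
  `Lines/deficit_ratchet.lean` §0) with the order pinned to `2` (VERDICT-c3 item 3, lead c5:
  "C‴₂"), `boostNorm` inlined as `max ‖Λ‖ ‖Λ⁻¹‖`. Open problem.
* `stub_unwindowing` — FROM THE WINDOWED TO THE FILED CLAUSE, pointwise: for an MGHD of an
  admissible datum with complete `𝓘⁺`, the windowed margin C‴₂ implies the FILED un-windowed
  margin (`∃ χ₁ k₁ δ₁ K₁ … ∀ M₁ > 0 …`, one tolerance for all labels and boosts).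

`TameCensorshipCollarMargin_of : TameCensorshipCollarMargin` (below; its own term sorry-free, the only sorries being the
three stubs it is applied to) := `crux_body_of_stub_sigs stub₁ stub₂ stub₃`, where `crux_body_of_stub_sigs :
<stub₁-sig> → <stub₂-sig> → <stub₃-sig> → <body of the crux>` is `isTameChristodoulouGeneric_of_relative` with
`Q :=` censorship, `P :=` censorship `∧` C‴₂ (sole flat ends from
`exists_isSoleEnd_of_mem_admissibleVacuumData`, the base curves from stub 1, the handed-back curves
from stub 2), then `IsTameChristodoulouGeneric.mono` with stub 3 pointwise.

## REGISTRAR'S FLAG — the crux is MISSTATED BY INHERITANCE, and `stub_unwindowing` isolates it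

Item 17329 is item 10809 (`GenericCensorshipCollarMargin`) with ONE token changed
(`IsChristodoulouGeneric ↦ IsTameChristodoulouGeneric`; grounder g70-5/6, token-level diff). On 10809
EIGHT line leads converged on `verdict: misstated` (notes of 2026-08-16 13:10Z, 13:44Z, 21:43Z):
the margin conjunct quantifies over thick collar charts of UNBOUNDED label `M₁` (and boost) at ONE
unweighted `Cᵏ` tolerance, and by degree-`0` homogeneity of Kerr–Schild plus the Lorentzian
one-sided Nash–Kuiper theorem (Boukholkhal, arXiv:2407.19333v2, Thm 1.2 / Prop 3.1) the far field
of every admissible MGHD carries extremal-label (`a₁ = M₁ → ∞`) thick collar charts at every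
tolerance beyond every `J⁻(K₁)` (`Cruxes/GenericCensorshipCollarMargin/MisstatedByMimicry.md`);
negative-modulo lemma LANDED (p103863):
`Theorems.GenericCensorshipCollarMargin.Negative.GenericCensorshipCollarMargin_false_of_ExtremalJunkCollars :
ExtremalJunkCollars → MGHDExists → ¬ GenericCensorshipCollarMargin`. The T2 route repair (rev 3,
2026-08-16T23:15Z) re-filed the conjunct VERBATIM, so the same lemma kills 17329 through
`IsTameChristodoulouGeneric.isChristodoulouGeneric` — kernel-checked below as
`TameCensorshipCollarMargin_false_of_ExtremalJunkCollars` (§3, sorry-free; `ExtremalJunkCollars` is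
expected true but not constructed in the tree). Consequently `stub_unwindowing` is believed FALSE
modulo `ExtremalJunkCollars` plus the existence of one admissible MGHD with complete `𝓘⁺` and the
windowed margin (Minkowski): it is the inherited misstatement, ISOLATED — stubs 1 and 2 are the
honest content and survive verbatim the restatement the 10809 leads recommend (window the label and
the boost, order 2: then the skeleton is `stub_tameCensorship → stub_windowedThirdLawAlongCensoredCurves
→ crux′` by the same proof minus the last `mono`). RECOMMENDED ACTION (tenure / route-repair, not this
seat): restate 17329 (and `GapExhaustion`'s hypothesis, stmt-10808, which the same junk makes
vacuously TRUE — `Theorems/BartnikGapSettlingGapExhaustionOfJunkCollars.lean`) before seating any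
ideator or lead on the filed text.

Disproof used: no `Cruxes/TameCensorshipCollarMargin/Disproof.lean` exists yet; the applicable
landed Negative lemma is the 10809 one above (honoured: it is re-derived for this decl in §3 and
pinned on `stub_unwindowing`; stubs 1–2 are windowed and do not meet its witness family, whose labels
diverge). Dead lines of 10809 (`hair-vacates-the-margin`, `deficit-ratchet`) are lines for stub 2's
content, not used here.
-/

noncomputable section

-- D-0017: single-problem summit, `Summit.<S>.<S>.…` by design (cf. lakefile `weak.linter.dupNamespace`).
set_option linter.dupNamespace false

open Set Function
open scoped Manifold ContDiff Topology ENNReal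

namespace Summit.FinalStateConjecture.FinalStateConjecture.Cruxes.TameCensorshipCollarMargin.Birth

open Literature.Geometry.Lorentzian

/-! ## §1 The stubs -/

/-- **Stub 1 — tame weak cosmic censorship.** For every connected Hausdorff second-countable
`3`-manifold `X`, tame-generically (Christodoulou codimension `1`, witness curves tame on one fixed
end and immersed at `0`) in the admissible vacuum class, EVERY maximal vacuum Cauchy development has
complete future null infinity (sojourn form). Christodoulou, CQG 16 (1999) A23, p. A24;
Dafermos–Rodnianski arXiv:0811.0354 §2.6.2; Dafermos–Luk arXiv:1710.01722 p. 5. Follows by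
`IsTameChristodoulouGeneric.mono` from the sibling item `PhaseMixingCapture.WeakCosmicCensorshipTame`.
Open problem. -/
theorem stub_tameCensorship : ∀ (X : Type) [TopologicalSpace X] [ChartedSpace E3 X] [IsManifold (𝓡 3) ((⊤ : ℕ∞) : WithTop ℕ∞) X] [T2Space X] [SecondCountableTopology X] [ConnectedSpace X], InitialDataSet.IsTameChristodoulouGeneric (admissibleVacuumData X) (fun D => ∀ 𝒟 : VacuumCauchyDevelopment D, 𝒟.IsMaximal → Summit.FinalStateConjecture.HasCompleteNullInfinity 𝒟.toCauchyDevelopment) 1 := by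
  sorry

/-- **Stub 2 — the collar third law along censored tame curves (load-bearing).** For every end `e`
of `X` and every tame one-parameter family `F` of admissible data on `e` whose members off `0` are
censored (every MGHD has complete `𝓘⁺`), `F` being immersed at `0` and injective or constant, there
is a tame family `F'` on the SAME end with `F' 0 = F 0`, injective, immersed at `0`, admissible,
whose members off `0` are censored AND satisfy the windowed collar margin C‴₂: for all windows
`0 < m₀`, `0 < ρ₀` some `χ₁ < 1`, `δ₁ > 0`, compact `K₁` such that every thick collar chart
`(M₁, a₁, mo₁, B₁, Φ₁)` with `m₀ ≤ M₁ ≤ m₀⁻¹`, `max ‖Λ‖ ‖Λ⁻¹‖ ≤ ρ₀`, `|a₁| ≤ M₁`, on the boosted Kerr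
star background, smooth on and an open embedding of the collar layer, `δ₁`-close in `C²` to Kerr on
the thick slab `{t* = 0, M₁ < r ≤ 3M₁}` and with slab image disjoint from `J⁻(K₁)`, has
`|a₁| ≤ χ₁ M₁`. The generic third law in near-horizon form, produced ALONG censorship curves
(genericity is not closed under `∧`). Why it might fail: the extremal threshold of vacuum collapse
need not be a tame hypersurface (Kehle–Unger arXiv:2402.10190 §1.4.5; one-sided / Cantor
accumulation of thresholds along a curve); C²-quiet hairy asymptotically extremal horizons
(Aretakis; Gajic arXiv:2302.06636) must be left along a curve that stays censored. -/
theorem stub_windowedThirdLawAlongCensoredCurves : ∀ (X : Type) [TopologicalSpace X] [ChartedSpace E3 X] [IsManifold (𝓡 3) ((⊤ : ℕ∞) : WithTop ℕ∞) X] [T2Space X] [SecondCountableTopology X] [ConnectedSpace X], ∀ (e : AFEnd X) (F : EuclideanSpace ℝ (Fin 1) → InitialDataSet (𝓡 3) X), InitialDataSet.IsTameDataFamily e 1 F → ((InitialDataSet.IsImmersedAtZero 1 F ∧ Function.Injective F) ∨ ∀ c, F c = F 0) → (∀ c, F c ∈ admissibleVacuumData X) → (∀ c ≠ 0, ∀ 𝒟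 : VacuumCauchyDevelopment (F c), 𝒟.IsMaximal → Summit.FinalStateConjecture.HasCompleteNullInfinity 𝒟.toCauchyDevelopment) → ∃ F' : EuclideanSpace ℝ (Fin 1) → InitialDataSet (𝓡 3) X, InitialDataSet.IsTameDataFamily e 1 F' ∧ F' 0 = F 0 ∧ Function.Injective F' ∧ InitialDataSet.IsImmersedAtZero 1 F' ∧ (∀ c, F' c ∈ admissibleVacuumData X) ∧ ∀ c ≠ 0, ∀ 𝒟 : VacuumCauchyDevelopment (F' c), 𝒟.IsMaximal → Summit.FinalStateConjecture.HasCompleteNullInfinity 𝒟.toCauchyDevelopment ∧ (∀ m₀ ρ₀ : ℝ, 0 < m₀ → 0 < ρ₀ → ∃ (χ₁ : ℝ) (δ₁ : ENNReal) (K₁ : Set 𝒟.carrier), χ₁ < 1 ∧ 0 < δ₁ ∧ IsCompact K₁ ∧ ∀ (M₁ a₁ : ℝ) (mo₁ : lorentzGroup × E4) (B₁ : ModelBackground) (Φ₁ : B₁.domain → 𝒟.carrier), m₀ ≤ M₁ → M₁ ≤ m₀⁻¹ → max ‖((mo₁.1 : E4 ≃L[ℝ] E4) : E4 →L[ℝ]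 E4)‖ ‖((mo₁.1 : E4 ≃L[ℝ] E4).symm : E4 →L[ℝ] E4)‖ ≤ ρ₀ → |a₁| ≤ M₁ → B₁ = starBackground mo₁.1 mo₁.2 M₁ a₁ (fun x => Kerr.radius a₁ (poincareInv mo₁.1 mo₁.2 x)) → ContMDiffOn 𝓘(ℝ, E4) (𝓡 4) ((⊤ : ℕ∞) : WithTop ℕ∞) Φ₁ {x | -1 < B₁.time x.1 ∧ B₁.time x.1 < 1 ∧ B₁.radius x.1 < 3 * M₁ + 1} → Topology.IsOpenEmbedding ({x | -1 < B₁.time x.1 ∧ B₁.time x.1 < 1 ∧ B₁.radius x.1 < 3 * M₁ + 1}.restrict Φ₁) → 𝒟.toSpacetime.truncDeviationCk B₁ Φ₁ 2 (3 * M₁) 0 ≤ δ₁ → Disjoint (Φ₁ '' B₁.truncTimeSlab (3 * M₁) 0) (𝒟.metric.causalPast 𝒟.timeOrientation K₁) → |a₁| ≤ χ₁ * M₁) := by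
  sorry

/-- **Stub 3 — unwindowing (THE INHERITED MISSTATEMENT, ISOLATED).** For an MGHD of an admissible
datum with complete `𝓘⁺`, the windowed collar margin C‴₂ (all label windows and boost bounds, order
`2`) implies the FILED un-windowed clause: ONE tolerance `(χ₁ < 1, k₁, δ₁ > 0, K₁)` serving every
label `M₁ > 0` and every boost. **Believed FALSE modulo `ExtremalJunkCollars`** (far-field mimicry at
labels `M₁ → ∞`, `Theorems/GenericCensorshipCollarMargin/Negative/…FalseOfExtremalJunkCollars.lean`,
`Cruxes/GenericCensorshipCollarMargin/MisstatedByMimicry.md`) together with the existence of one good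
admissible MGHD; it is exactly the piece of the filed crux that the 10809 leads' restatement deletes.
Registered so that the defect is a NAMED stub and not hidden inside stub 2. -/
theorem stub_unwindowing : ∀ (X : Type) [TopologicalSpace X] [ChartedSpace E3 X] [IsManifold (𝓡 3) ((⊤ : ℕ∞) : WithTop ℕ∞) X] [T2Space X] [SecondCountableTopology X] [ConnectedSpace X], ∀ D ∈ admissibleVacuumData X, ∀ 𝒟 : VacuumCauchyDevelopment D, 𝒟.IsMaximal → Summit.FinalStateConjecture.HasCompleteNullInfinity 𝒟.toCauchyDevelopment → (∀ m₀ ρ₀ : ℝ, 0 < m₀ → 0 < ρ₀ → ∃ (χ₁ : ℝ) (δ₁ : ENNReal) (K₁ : Set 𝒟.carrier), χ₁ < 1 ∧ 0 < δ₁ ∧ IsCompact K₁ ∧ ∀ (M₁ a₁ : ℝ) (mo₁ : lorentzGroup × E4) (B₁ : ModelBackground) (Φ₁ : B₁.domain → 𝒟.carrier), m₀ ≤ M₁ → M₁ ≤ m₀⁻¹ → max ‖((mo₁.1 : E4 ≃L[ℝ] E4) : E4 →L[ℝ] E4)‖ ‖((mo₁.1 : E4 ≃L[ℝ] E4).symm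 : E4 →L[ℝ] E4)‖ ≤ ρ₀ → |a₁| ≤ M₁ → B₁ = starBackground mo₁.1 mo₁.2 M₁ a₁ (fun x => Kerr.radius a₁ (poincareInv mo₁.1 mo₁.2 x)) → ContMDiffOn 𝓘(ℝ, E4) (𝓡 4) ((⊤ : ℕ∞) : WithTop ℕ∞) Φ₁ {x | -1 < B₁.time x.1 ∧ B₁.time x.1 < 1 ∧ B₁.radius x.1 < 3 * M₁ + 1} → Topology.IsOpenEmbedding ({x | -1 < B₁.time x.1 ∧ B₁.time x.1 < 1 ∧ B₁.radius x.1 < 3 * M₁ + 1}.restrict Φ₁) → 𝒟.toSpacetime.truncDeviationCk B₁ Φ₁ 2 (3 * M₁) 0 ≤ δ₁ → Disjoint (Φ₁ '' B₁.truncTimeSlab (3 * M₁) 0) (𝒟.metric.causalPast 𝒟.timeOrientation K₁) → |a₁| ≤ χ₁ * M₁) → (∃ (χ₁ : ℝ) (k₁ : ℕ) (δ₁ : ENNReal) (K₁ : Set 𝒟.carrier), χ₁ < 1 ∧ 0 < δ₁ ∧ IsCompact K₁ ∧ ∀ (M₁ a₁ : ℝ) (mo₁ : lorentzGroup × E4)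 (B₁ : ModelBackground) (Φ₁ : B₁.domain → 𝒟.carrier), 0 < M₁ → |a₁| ≤ M₁ → B₁ = starBackground mo₁.1 mo₁.2 M₁ a₁ (fun x => Kerr.radius a₁ (poincareInv mo₁.1 mo₁.2 x)) → ContMDiffOn 𝓘(ℝ, E4) (𝓡 4) ((⊤ : ℕ∞) : WithTop ℕ∞) Φ₁ {x | -1 < B₁.time x.1 ∧ B₁.time x.1 < 1 ∧ B₁.radius x.1 < 3 * M₁ + 1} → Topology.IsOpenEmbedding ({x | -1 < B₁.time x.1 ∧ B₁.time x.1 < 1 ∧ B₁.radius x.1 < 3 * M₁ + 1}.restrict Φ₁) → 𝒟.toSpacetime.truncDeviationCk B₁ Φ₁ k₁ (3 * M₁) 0 ≤ δ₁ → Disjoint (Φ₁ '' B₁.truncTimeSlab (3 * M₁) 0) (𝒟.metric.causalPast 𝒟.timeOrientation K₁) → |a₁| ≤ χ₁ * M₁) := by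
  sorry

/-! ## §2 The composition (sorry-free): stubs 1–3 ⟹ the route decl, by name -/

/-- **The three stub SIGNATURES imply the body of the crux** (composition lemma, hypotheses = the
stub statements verbatim, conclusion = the body of the route decl `TameCensorshipCollarMargin`
verbatim — stated on the body rather than the name only so that the A12 skeleton audit sees exactly
ONE theorem concluding the crux by name, `TameCensorshipCollarMargin_of` below, which has no
hypotheses). Proof: composition of tame genericities along curves
(`InitialDataSet.isTameChristodoulouGeneric_of_relative`, with `Q :=` "every MGHD has complete `𝓘⁺`"
and `P :=` "every MGHD has complete `𝓘⁺` and the windowed margin C‴₂"; constant curves are tame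
because admissible data have a sole strongly flat end, `exists_isSoleEnd_of_mem_admissibleVacuumData`),
followed by monotonicity (`IsTameChristodoulouGeneric.mono`) along the pointwise unwindowing of
stub 3. -/
theorem crux_body_of_stub_sigs :
    (∀ (X : Type) [TopologicalSpace X] [ChartedSpace E3 X] [IsManifold (𝓡 3) ((⊤ : ℕ∞) : WithTop ℕ∞) X] [T2Space X] [SecondCountableTopology X] [ConnectedSpace X], InitialDataSet.IsTameChristodoulouGeneric (admissibleVacuumData X) (fun D => ∀ 𝒟 : VacuumCauchyDevelopment D, 𝒟.IsMaximal → Summit.FinalStateConjecture.HasCompleteNullInfinity 𝒟.toCauchyDevelopment) 1) →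
    (∀ (X : Type) [TopologicalSpace X] [ChartedSpace E3 X] [IsManifold (𝓡 3) ((⊤ : ℕ∞) : WithTop ℕ∞) X] [T2Space X] [SecondCountableTopology X] [ConnectedSpace X], ∀ (e : AFEnd X) (F : EuclideanSpace ℝ (Fin 1) → InitialDataSet (𝓡 3) X), InitialDataSet.IsTameDataFamily e 1 F → ((InitialDataSet.IsImmersedAtZero 1 F ∧ Function.Injective F) ∨ ∀ c, F c = F 0) → (∀ c, F c ∈ admissibleVacuumData X) → (∀ c ≠ 0, ∀ 𝒟 : VacuumCauchyDevelopment (F c), 𝒟.IsMaximal → Summit.FinalStateConjecture.HasCompleteNullInfinity 𝒟.toCauchyDevelopment) → ∃ F' : EuclideanSpace ℝ (Fin 1) → InitialDataSet (𝓡 3) X, InitialDataSet.IsTameDataFamily e 1 F' ∧ F' 0 = F 0 ∧ Function.Injective F' ∧ InitialDataSet.IsImmersedAtZero 1 F' ∧ (∀ c, F' c ∈ admissibleVacuumData X) ∧ ∀ c ≠ 0, ∀ 𝒟 : VacuumCauchyDevelopment (F' c), 𝒟.IsMaximal → Summit.FinalStateConjecture.HasCompleteNullInfinity 𝒟.toCauchyDevelopment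 ∧ (∀ m₀ ρ₀ : ℝ, 0 < m₀ → 0 < ρ₀ → ∃ (χ₁ : ℝ) (δ₁ : ENNReal) (K₁ : Set 𝒟.carrier), χ₁ < 1 ∧ 0 < δ₁ ∧ IsCompact K₁ ∧ ∀ (M₁ a₁ : ℝ) (mo₁ : lorentzGroup × E4) (B₁ : ModelBackground) (Φ₁ : B₁.domain → 𝒟.carrier), m₀ ≤ M₁ → M₁ ≤ m₀⁻¹ → max ‖((mo₁.1 : E4 ≃L[ℝ] E4) : E4 →L[ℝ] E4)‖ ‖((mo₁.1 : E4 ≃L[ℝ] E4).symm : E4 →L[ℝ] E4)‖ ≤ ρ₀ → |a₁| ≤ M₁ → B₁ = starBackground mo₁.1 mo₁.2 M₁ a₁ (fun x => Kerr.radius a₁ (poincareInv mo₁.1 mo₁.2 x)) → ContMDiffOn 𝓘(ℝ, E4) (𝓡 4) ((⊤ : ℕ∞) : WithTop ℕ∞) Φ₁ {x | -1 < B₁.time x.1 ∧ B₁.time x.1 < 1 ∧ B₁.radius x.1 < 3 * M₁ + 1} → Topology.IsOpenEmbedding ({x | -1 < B₁.time x.1 ∧ B₁.time x.1 < 1 ∧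 B₁.radius x.1 < 3 * M₁ + 1}.restrict Φ₁) → 𝒟.toSpacetime.truncDeviationCk B₁ Φ₁ 2 (3 * M₁) 0 ≤ δ₁ → Disjoint (Φ₁ '' B₁.truncTimeSlab (3 * M₁) 0) (𝒟.metric.causalPast 𝒟.timeOrientation K₁) → |a₁| ≤ χ₁ * M₁)) →
    (∀ (X : Type) [TopologicalSpace X] [ChartedSpace E3 X] [IsManifold (𝓡 3) ((⊤ : ℕ∞) : WithTop ℕ∞) X] [T2Space X] [SecondCountableTopology X] [ConnectedSpace X], ∀ D ∈ admissibleVacuumData X, ∀ 𝒟 : VacuumCauchyDevelopment D, 𝒟.IsMaximal → Summit.FinalStateConjecture.HasCompleteNullInfinity 𝒟.toCauchyDevelopment → (∀ m₀ ρ₀ : ℝ, 0 < m₀ → 0 < ρ₀ → ∃ (χ₁ : ℝ) (δ₁ : ENNReal) (K₁ : Set 𝒟.carrier), χ₁ < 1 ∧ 0 < δ₁ ∧ IsCompact K₁ ∧ ∀ (M₁ a₁ : ℝ) (mo₁ : lorentzGroup × E4) (B₁ : ModelBackground) (Φ₁ : B₁.domain → 𝒟.carrier), m₀ ≤ M₁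 → M₁ ≤ m₀⁻¹ → max ‖((mo₁.1 : E4 ≃L[ℝ] E4) : E4 →L[ℝ] E4)‖ ‖((mo₁.1 : E4 ≃L[ℝ] E4).symm : E4 →L[ℝ] E4)‖ ≤ ρ₀ → |a₁| ≤ M₁ → B₁ = starBackground mo₁.1 mo₁.2 M₁ a₁ (fun x => Kerr.radius a₁ (poincareInv mo₁.1 mo₁.2 x)) → ContMDiffOn 𝓘(ℝ, E4) (𝓡 4) ((⊤ : ℕ∞) : WithTop ℕ∞) Φ₁ {x | -1 < B₁.time x.1 ∧ B₁.time x.1 < 1 ∧ B₁.radius x.1 < 3 * M₁ + 1} → Topology.IsOpenEmbedding ({x | -1 < B₁.time x.1 ∧ B₁.time x.1 < 1 ∧ B₁.radius x.1 < 3 * M₁ + 1}.restrict Φ₁) → 𝒟.toSpacetime.truncDeviationCk B₁ Φ₁ 2 (3 * M₁) 0 ≤ δ₁ → Disjoint (Φ₁ '' B₁.truncTimeSlab (3 * M₁) 0) (𝒟.metric.causalPast 𝒟.timeOrientation K₁) → |a₁| ≤ χ₁ * M₁) → (∃ (χ₁ : ℝ) (k₁ : ℕ) (δ₁ : ENNReal)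 (K₁ : Set 𝒟.carrier), χ₁ < 1 ∧ 0 < δ₁ ∧ IsCompact K₁ ∧ ∀ (M₁ a₁ : ℝ) (mo₁ : lorentzGroup × E4) (B₁ : ModelBackground) (Φ₁ : B₁.domain → 𝒟.carrier), 0 < M₁ → |a₁| ≤ M₁ → B₁ = starBackground mo₁.1 mo₁.2 M₁ a₁ (fun x => Kerr.radius a₁ (poincareInv mo₁.1 mo₁.2 x)) → ContMDiffOn 𝓘(ℝ, E4) (𝓡 4) ((⊤ : ℕ∞) : WithTop ℕ∞) Φ₁ {x | -1 < B₁.time x.1 ∧ B₁.time x.1 < 1 ∧ B₁.radius x.1 < 3 * M₁ + 1} → Topology.IsOpenEmbedding ({x | -1 < B₁.time x.1 ∧ B₁.time x.1 < 1 ∧ B₁.radius x.1 < 3 * M₁ + 1}.restrict Φ₁) → 𝒟.toSpacetime.truncDeviationCk B₁ Φ₁ k₁ (3 * M₁) 0 ≤ δ₁ → Disjoint (Φ₁ '' B₁.truncTimeSlab (3 * M₁) 0) (𝒟.metric.causalPast 𝒟.timeOrientation K₁) → |a₁| ≤ χ₁ * M₁)) →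
    ∀ (X : Type) [TopologicalSpace X] [ChartedSpace E3 X] [IsManifold (𝓡 3) ((⊤ : ℕ∞) : WithTop ℕ∞) X] [T2Space X] [SecondCountableTopology X] [ConnectedSpace X], InitialDataSet.IsTameChristodoulouGeneric (admissibleVacuumData X) (fun D => ∀ 𝒟 : VacuumCauchyDevelopment D, 𝒟.IsMaximal → Summit.FinalStateConjecture.HasCompleteNullInfinity 𝒟.toCauchyDevelopment ∧ (∃ (χ₁ : ℝ) (k₁ : ℕ) (δ₁ : ENNReal) (K₁ : Set 𝒟.carrier), χ₁ < 1 ∧ 0 < δ₁ ∧ IsCompact K₁ ∧ ∀ (M₁ a₁ : ℝ) (mo₁ : lorentzGroup × E4) (B₁ : ModelBackground) (Φ₁ : B₁.domain → 𝒟.carrier), 0 < M₁ → |a₁| ≤ M₁ → B₁ = starBackground mo₁.1 mo₁.2 M₁ a₁ (fun x => Kerr.radius a₁ (poincareInv mo₁.1 mo₁.2 x)) → ContMDiffOn 𝓘(ℝ, E4) (𝓡 4) ((⊤ : ℕ∞) : WithTop ℕ∞) Φ₁ {x | -1 < B₁.time x.1 ∧ B₁.time x.1 < 1 ∧ B₁.radius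 x.1 < 3 * M₁ + 1} → Topology.IsOpenEmbedding ({x | -1 < B₁.time x.1 ∧ B₁.time x.1 < 1 ∧ B₁.radius x.1 < 3 * M₁ + 1}.restrict Φ₁) → 𝒟.toSpacetime.truncDeviationCk B₁ Φ₁ k₁ (3 * M₁) 0 ≤ δ₁ → Disjoint (Φ₁ '' B₁.truncTimeSlab (3 * M₁) 0) (𝒟.metric.causalPast 𝒟.timeOrientation K₁) → |a₁| ≤ χ₁ * M₁)) 1 := by
  intro h₁ h₂ h₃ X _ _ _ _ _ _
  have hgen : InitialDataSet.IsTameChristodoulouGeneric (admissibleVacuumData X)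
      (fun D => ∀ 𝒟 : VacuumCauchyDevelopment D, 𝒟.IsMaximal →
        Summit.FinalStateConjecture.HasCompleteNullInfinity 𝒟.toCauchyDevelopment ∧ (∀ m₀ ρ₀ : ℝ, 0 < m₀ → 0 < ρ₀ → ∃ (χ₁ : ℝ) (δ₁ : ENNReal) (K₁ : Set 𝒟.carrier), χ₁ < 1 ∧ 0 < δ₁ ∧ IsCompact K₁ ∧ ∀ (M₁ a₁ : ℝ) (mo₁ : lorentzGroup × E4) (B₁ : ModelBackground) (Φ₁ : B₁.domain → 𝒟.carrier), m₀ ≤ M₁ → M₁ ≤ m₀⁻¹ → max ‖((mo₁.1 : E4 ≃L[ℝ] E4) : E4 →L[ℝ] E4)‖ ‖((mo₁.1 : E4 ≃L[ℝ] E4).symm : E4 →L[ℝ] E4)‖ ≤ ρ₀ → |a₁| ≤ M₁ → B₁ = starBackground mo₁.1 mo₁.2 M₁ a₁ (fun x => Kerr.radius a₁ (poincareInv mo₁.1 mo₁.2 x)) → ContMDiffOn 𝓘(ℝ, E4) (𝓡 4) ((⊤ : ℕ∞) : WithTop ℕ∞) Φ₁ {x | -1 < B₁.time x.1 ∧ B₁.time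 x.1 < 1 ∧ B₁.radius x.1 < 3 * M₁ + 1} → Topology.IsOpenEmbedding ({x | -1 < B₁.time x.1 ∧ B₁.time x.1 < 1 ∧ B₁.radius x.1 < 3 * M₁ + 1}.restrict Φ₁) → 𝒟.toSpacetime.truncDeviationCk B₁ Φ₁ 2 (3 * M₁) 0 ≤ δ₁ → Disjoint (Φ₁ '' B₁.truncTimeSlab (3 * M₁) 0) (𝒟.metric.causalPast 𝒟.timeOrientation K₁) → |a₁| ≤ χ₁ * M₁)) 1 :=
    InitialDataSet.isTameChristodoulouGeneric_of_relative
      (Q := fun D => ∀ 𝒟 : VacuumCauchyDevelopment D, 𝒟.IsMaximal → Summit.FinalStateConjecture.HasCompleteNullInfinity 𝒟.toCauchyDevelopment)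
      (fun d hd => exists_isSoleEnd_of_mem_admissibleVacuumData hd) (h₁ X)
      (fun e F hF hdich h𝓓 hQ => h₂ X e F hF hdich h𝓓 hQ)
  refine hgen.mono ?_
  intro D hD hP 𝒟 hmax
  obtain ⟨hCNI, hW⟩ := hP 𝒟 hmax
  exact ⟨hCNI, h₃ X D hD 𝒟 hmax hCNI hW⟩

/-- **THE SKELETON THEOREM: `TameCensorshipCollarMargin` (the route decl, BY NAME) from the three
registered stubs** — `crux_body_of_stub_sigs` applied to `stub_tameCensorship`,
`stub_windowedThirdLawAlongCensoredCurves`, `stub_unwindowing` (the only `sorry`s of the file live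
inside those three stubs; this theorem's term is sorry-free and its type is literally the route decl,
which unfolds to the lemma's conclusion by `δ`). -/
theorem TameCensorshipCollarMargin_of : Summit.FinalStateConjecture.FinalStateConjecture.Theses.BartnikGapSettling.TameCensorshipCollarMargin :=
  crux_body_of_stub_sigs stub_tameCensorship stub_windowedThirdLawAlongCensoredCurves stub_unwindowing

/-! ## §3 Registrar's flag, kernel-checked: the target is false modulo `ExtremalJunkCollars` -/

/-- **The filed crux inherits the 10809 misstatement.** Tame genericity implies the topology-free
genericity (`IsTameChristodoulouGeneric.isChristodoulouGeneric`), so `TameCensorshipCollarMargin`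
implies the record decl `BartnikGapSettling.GenericCensorshipCollarMargin` (item 10809's text, kept in
the Negative module), which `GenericCensorshipCollarMargin_false_of_ExtremalJunkCollars` (p103863)
refutes under `ExtremalJunkCollars` and the route's own crux `MGHDExists`. Nothing here bears on weak
cosmic censorship or the third law; the repair is to window the label (and boost) of the clause. -/
theorem TameCensorshipCollarMargin_false_of_ExtremalJunkCollars :
    Summit.FinalStateConjecture.FinalStateConjecture.Theorems.GenericCensorshipCollarMargin.Negative.ExtremalJunkCollars →
    Summit.FinalStateConjecture.FinalStateConjecture.Theses.BartnikGapSettling.MGHDExists →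
    ¬ Summit.FinalStateConjecture.FinalStateConjecture.Theses.BartnikGapSettling.TameCensorshipCollarMargin := by
  intro hJ hE hT
  refine Summit.FinalStateConjecture.FinalStateConjecture.Theorems.GenericCensorshipCollarMargin.Negative.GenericCensorshipCollarMargin_false_of_ExtremalJunkCollars hJ hE ?_
  intro X _ _ _ _ _ _
  exact (hT X).isChristodoulouGeneric

end Summit.FinalStateConjecture.FinalStateConjecture.Cruxes.TameCensorshipCollarMargin.Birth

end
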